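import Mathlib

/-!
# Level pigeonhole: one level block carries at least the average

Crux `Summit.MatrixMultiplication.MatrixMultiplication.Theses.SnSubsetDichotomy.PolynomialSlack`
(item `stmt-MatrixMultiplication-8306`), level-one programme, lead c8 (general hub lemma, level pigeonhole).

Two finite blocks `J` (positions of `T`) and `I` (positions of `S`) carry levels `ℓJ`, `ℓI` with values
in `{0, …, L}`; a bi-indexed quantity `g j i` summed over `J × I` splits into the `(L+1)²` level blocks
`Block(a,b) = Σ_{j ∈ J, ℓJ j = a} Σ_{i ∈ I, ℓI i = b} g j i`, and some level pair `(a,b)` with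
`a, b ≤ L` has `Block(a,b) ≥ (Σ_{j ∈ J} Σ_{i ∈ I} g j i)/(L+1)²` (`levelBlock_pigeonhole`).

Proof. `Σ_{a ≤ L} Σ_{b ≤ L} Block(a,b) = Σ_{J} Σ_{I} g` (fibre the `I`-sum along `ℓI` and then the
`J`-sum along `ℓJ`; both level maps land in `range (L+1)`), and a sum of `(L+1)²` real numbers is at
most `(L+1)²` times its largest term.  (Nonnegativity of `g` is part of the registered statement but
is not needed for the inequality.)
-/

namespace Summit.MatrixMultiplication.MatrixMultiplication.Theorems.PolynomialSlack

set_option linter.dupNamespace false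

open scoped BigOperators

/-- **Double fibre identity.** Summing the level blocks
`Σ_{j ∈ J, ℓJ j = a} Σ_{i ∈ I, ℓI i = b} g j i` over all level pairs `(a,b) ∈ range (L+1) × range (L+1)`
recovers the full double sum `Σ_{j ∈ J} Σ_{i ∈ I} g j i`, provided all levels are `≤ L`
(two applications of `Finset.sum_fiberwise_of_maps_to`). [folklore] -/
theorem levelPigeonhole_sum_blocks {α β : Type*} (J : Finset α) (I : Finset β) (g : α → β → ℝ)
    (ℓJ : α → ℕ) (ℓI : β → ℕ) (L : ℕ) (hJ : ∀ j ∈ J, ℓJ j ≤ L) (hI : ∀ i ∈ I, ℓI i ≤ L) :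
    ∑ p ∈ Finset.range (L + 1) ×ˢ Finset.range (L + 1),
        ∑ j ∈ J.filter (fun j => ℓJ j = p.1), ∑ i ∈ I.filter (fun i => ℓI i = p.2), g j i
      = ∑ j ∈ J, ∑ i ∈ I, g j i := by
  have hJ' : ∀ j ∈ J, ℓJ j ∈ Finset.range (L + 1) := fun j hj =>
    Finset.mem_range.2 (Nat.lt_succ_of_le (hJ j hj))
  have hI' : ∀ i ∈ I, ℓI i ∈ Finset.range (L + 1) := fun i hi =>
    Finset.mem_range.2 (Nat.lt_succ_of_le (hI i hi))
  -- fibre the inner sum along `ℓI`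
  have inner : ∀ j, ∑ b ∈ Finset.range (L + 1), ∑ i ∈ I.filter (fun i => ℓI i = b), g j i
      = ∑ i ∈ I, g j i :=
    fun j => Finset.sum_fiberwise_of_maps_to hI' (fun i => g j i)
  rw [Finset.sum_product]
  calc ∑ a ∈ Finset.range (L + 1), ∑ b ∈ Finset.range (L + 1),
          ∑ j ∈ J.filter (fun j => ℓJ j = a), ∑ i ∈ I.filter (fun i => ℓI i = b), g j i
        = ∑ a ∈ Finset.range (L + 1), ∑ j ∈ J.filter (fun j => ℓJ j = a),
            ∑ b ∈ Finset.range (L + 1), ∑ i ∈ I.filter (fun i => ℓI i = b), g j i :=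
          Finset.sum_congr rfl fun a _ => Finset.sum_comm
    _ = ∑ a ∈ Finset.range (L + 1), ∑ j ∈ J.filter (fun j => ℓJ j = a), ∑ i ∈ I, g j i :=
          Finset.sum_congr rfl fun a _ => Finset.sum_congr rfl fun j _ => inner j
    _ = ∑ j ∈ J, ∑ i ∈ I, g j i :=
          Finset.sum_fiberwise_of_maps_to hJ' (fun j => ∑ i ∈ I, g j i)

/-- **Level pigeonhole.** For finite blocks `J`, `I`, a nonnegative bi-indexed quantity `g`, and
level maps `ℓJ`, `ℓI` with values `≤ L` on `J`, `I`, some level pair `(a,b)` with `a, b ≤ L` has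
level block `Σ_{j ∈ J, ℓJ j = a} Σ_{i ∈ I, ℓI i = b} g j i ≥ (Σ_{j ∈ J} Σ_{i ∈ I} g j i)/(L+1)²`:
the `(L+1)²` level blocks partition the double sum (`levelPigeonhole_sum_blocks`) and the largest
block is at least the average. [folklore] -/
theorem levelBlock_pigeonhole {α β : Type*} [DecidableEq α] [DecidableEq β]
    (J : Finset α) (I : Finset β) (g : α → β → ℝ) (hg : ∀ j ∈ J, ∀ i ∈ I, 0 ≤ g j i)
    (ℓJ : α → ℕ) (ℓI : β → ℕ) (L : ℕ) (hJ : ∀ j ∈ J, ℓJ j ≤ L) (hI : ∀ i ∈ I, ℓI i ≤ L) :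
    ∃ a b : ℕ, a ≤ L ∧ b ≤ L ∧
      (∑ j ∈ J, ∑ i ∈ I, g j i) / ((L : ℝ) + 1) ^ 2 ≤
        ∑ j ∈ J.filter (fun j => ℓJ j = a), ∑ i ∈ I.filter (fun i => ℓI i = b), g j i := by
  -- nonnegativity of `g` is part of the registered statement but not needed for the inequality
  have _ := hg
  -- the set of level pairs, nonempty as it contains `(0,0)`
  have hRne : (Finset.range (L + 1) ×ˢ Finset.range (L + 1)).Nonempty :=
    ⟨(0, 0), Finset.mem_product.2 ⟨Finset.mem_range.2 L.succ_pos, Finset.mem_range.2 L.succ_pos⟩⟩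
  -- a level pair with the largest block
  obtain ⟨p, hpR, hpmax⟩ := Finset.exists_max_image
    (Finset.range (L + 1) ×ˢ Finset.range (L + 1))
    (fun p : ℕ × ℕ =>
      ∑ j ∈ J.filter (fun j => ℓJ j = p.1), ∑ i ∈ I.filter (fun i => ℓI i = p.2), g j i) hRne
  rw [Finset.mem_product, Finset.mem_range, Finset.mem_range] at hpR
  refine ⟨p.1, p.2, Nat.le_of_lt_succ hpR.1, Nat.le_of_lt_succ hpR.2, ?_⟩
  have hpos : (0 : ℝ) < ((L : ℝ) + 1) ^ 2 := by positivity
  rw [div_le_iff₀ hpos]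
  calc ∑ j ∈ J, ∑ i ∈ I, g j i
        = ∑ q ∈ Finset.range (L + 1) ×ˢ Finset.range (L + 1),
            ∑ j ∈ J.filter (fun j => ℓJ j = q.1), ∑ i ∈ I.filter (fun i => ℓI i = q.2), g j i :=
          (levelPigeonhole_sum_blocks J I g ℓJ ℓI L hJ hI).symm
    _ ≤ (Finset.range (L + 1) ×ˢ Finset.range (L + 1)).card •
          ∑ j ∈ J.filter (fun j => ℓJ j = p.1), ∑ i ∈ I.filter (fun i => ℓI i = p.2), g j i :=
          Finset.sum_le_card_nsmul _ _ _ hpmax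
    _ = (∑ j ∈ J.filter (fun j => ℓJ j = p.1), ∑ i ∈ I.filter (fun i => ℓI i = p.2), g j i)
          * ((L : ℝ) + 1) ^ 2 := by
          rw [Finset.card_product, Finset.card_range, nsmul_eq_mul]
          push_cast
          ring

end Summit.MatrixMultiplication.MatrixMultiplication.Theorems.PolynomialSlack
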